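import Summits.QuantumFields.YangMills.Theorems.BalabanLadderUVSeamRecCeilingsResponseMoments
import HarnessLib

/-!
# Crux `BalabanLadder.NT` (stmt-QuantumFields-19353), LINE τ «typical currency» (planner ym-idea-6 g14, published skeleton
# `Cruxes/NT/Lines/typical_currency_birth.lean` rev 4; critic idea-crit-9 VERDICT #72 PASS-WITH-PRICE):
# support T1 `stub_pairCollarOfResponse : pre ResponseLaw → PairCollar6`, PROVED

The μ-TYPICAL singleton response-moment law `ResponseLaw G r a` (RM₁: `⟨exp((R⁴/C₁)|kerE_Q(plane)(lift ·) − p|)⟩_{2L+1,β}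
≤ e^B` for the radius-`R+1` cube `Q` around the plaquette) pays the `n = 2` collar output `PairCollar6 G r a`
(`|⟨(P₁ − ⟨P₁⟩)(P₂ − ⟨P₂⟩)⟩| ≤ (C/R⁴)²` for two plane fields `2R+4`-separated cyclically in some coordinate).

PROOF.  No torus translation and no `L²` peeling are needed: the tree's TEMPERED-RESPONSE COLLAR
`UVSeamRec.TemperedResponse.abs_integral_prod_sub_mean_le_of_response` (p530862; DLR step on the two radius-`R+1`
cubes, whose interiors and boundaries are disjoint on the torus by the cyclic separation — `torusEdge_ne_cube`,
`injOn_torusProj_cube`, `isCylinder_plane_cube`, exactly the geometry of `momentBounds6_of_temperedResponse`) is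
`n`-resolved.  Take the influence functional `Y_i := (R⁴/(2C₁))·|kerE_{Q_i}(plane_i) − p_i|` (HALF the rate of RM₁):
the response law `|kerE − p| ≤ (2C₁/R⁴)(1 + Y)` is an identity, and the JOINT exponential moments over `T ⊆ Fin 2`
follow from the two SINGLETON laws by `exp(½Z₁ + ½Z₂) ≤ ½(e^{Z₁} + e^{Z₂})`:  `⟨exp Σ_{i∈T} Y_i⟩ ≤ e^{B} ≤ e^{B⁺·#T}`
(`B⁺ = max B 0`, `T ≠ ∅`; `T = ∅` is trivial).  Hence `PairCollar6` with `C = 2C₁(2 + e^{B⁺})e^{B⁺}`, `β₄ = β₁`,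
`ℓ₄ = ℓ₁`.  (For `n ≥ 3` points the singleton law does not control the joint moments at a fixed rate — this is why
LINE τ's currency is the PAIR collar.)

The statement is the skeleton's `__Registered.stub_pairCollarOfResponse` with `ResponseLaw` / `PairCollar6` unfolded
(byte-identical bodies), so the skeleton closes T1 by `exact pairCollar6_of_responseLaw`.

HONEST FRAMING: conditional support (plumbing); `ResponseLaw` (= item 23837's conclusion at the unit), the engine stubs
and `ShellSign` are NOT proved; no NT statement, rung or summit; the Yang–Mills mass gap is NOT proved.
Cell `ym-idea-1`, width seat `ym-line-sfw-p2-w3` g33 (free hands), `--supports stmt-QuantumFields-19353 --as helper`.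
[folklore: Georgii (2011) Thm. 4.17 for the DLR part]
-/

set_option autoImplicit false

noncomputable section

open MeasureTheory Filter Topology Finset
open Literature.Probability.LatticeModels
open Literature.MathematicalPhysics.QuantumFieldTheory (GaugeConfig wilsonMeasure isProbabilityMeasure_wilsonMeasure
  measurable_torusLift LatticeRep)
open Literature.MathematicalPhysics.QuantumLattice
open Summit.QuantumFields.YangMills.Cruxes.OSLegsFromFemtoAndGap.DlrCollarTransfer
open Summit.QuantumFields.YangMills.Cruxes.UVSeamRec.TemperedResponse
  (abs_integral_prod_sub_mean_le_of_response continuous_kerE_plane abs_kerE_plane_le)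

namespace Summit.QuantumFields.YangMills.Theorems.PairCollarOfResponse

/-- `exp` at a midpoint is at most the average of the endpoint values (AM–GM for `e^{a/2}`, `e^{b/2}`). [folklore] -/
theorem exp_half_add_le (a b : ℝ) : Real.exp ((a + b) / 2) ≤ (Real.exp a + Real.exp b) / 2 := by
  have ha : Real.exp a = Real.exp (a / 2) * Real.exp (a / 2) := by rw [← Real.exp_add]; ring_nf
  have hb : Real.exp b = Real.exp (b / 2) * Real.exp (b / 2) := by rw [← Real.exp_add]; ring_nf
  have hab : Real.exp ((a + b) / 2) = Real.exp (a / 2) * Real.exp (b / 2) := by rw [← Real.exp_add]; ring_nf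
  rw [ha, hb, hab]
  nlinarith [sq_nonneg (Real.exp (a / 2) - Real.exp (b / 2))]

/-- **T1 `stub_pairCollarOfResponse` of LINE τ**: at any unit, the μ-typical singleton response-moment law `ResponseLaw`
gives the pair collar `PairCollar6` (constant `C = 2C₁(2 + e^{B⁺})e^{B⁺}`, `B⁺ = max B 0`; thresholds `β₁`, `ℓ₁`).
[folklore: Georgii (2011) Thm. 4.17 for the DLR part] -/
theorem pairCollar6_of_responseLaw :
    ∀ (G : Type) [Group G] [TopologicalSpace G] [IsTopologicalGroup G] [CompactSpace G],
      Literature.MathematicalPhysics.QuantumFieldTheory.IsCompactSimpleLieGroup G → letI : MeasurableSpace G := borel G;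
      haveI : BorelSpace G := ⟨rfl⟩; ∀ (r : Literature.MathematicalPhysics.QuantumFieldTheory.LatticeRep G) (a : ℝ → ℝ),
      (∀ β, 0 < a β) → Filter.Tendsto a Filter.atTop (nhds 0) →
      (∃ (p : Fin 4 × Fin 4 → ℝ → ℝ) (C₁ B β₁ ℓ₁ : ℝ), 0 < C₁ ∧ 0 < ℓ₁ ∧ ∀ β : ℝ, β₁ ≤ β → ∀ (L : ℕ) (q : Fin 4 × Fin 4) (x : Fin 4 → ℤ) (R : ℕ), q.1 < q.2 → 1 ≤ R → (R : ℝ) * a β ≤ ℓ₁ → 4 * R + 8 ≤ L → torusE G r β L (fun U => Real.exp ((R : ℝ) ^ 4 / C₁ * |kerE G r β (fun k => x k - ((R : ℤ) + 1)) (2 * R + 3) U (plane G r q x) - p q β|)) ≤ Real.exp B) →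
      (∃ (C β₄ ℓ₄ : ℝ), 0 < ℓ₄ ∧ 0 ≤ C ∧ ∀ β : ℝ, β₄ ≤ β → ∀ (L : ℕ) (q : Fin 2 → Fin 4 × Fin 4) (x : Fin 2 → (Fin 4 → ℤ)) (R : ℕ), (∀ i, (q i).1 < (q i).2) → 1 ≤ R → (R : ℝ) * a β ≤ ℓ₄ → 4 * R + 8 ≤ L → (∀ i j : Fin 2, i ≠ j → ∃ k : Fin 4, (2 * (R : ℤ) + 4) ≤ |((((x i k - x j k : ℤ) : ZMod (2 * L + 1))).valMinAbs : ℤ)|) → |torusE G r β L (fun U => ∏ i, (plane G r (q i) (x i) U - torusE G r β L (plane G r (q i) (x i))))| ≤ (C / (R : ℝ) ^ 4) ^ 2) := by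
  intro G _ _ _ _ _hG r a _ha _ha0 hRL
  letI : MeasurableSpace G := borel G
  haveI : BorelSpace G := ⟨rfl⟩
  haveI : SecondCountableTopology G :=
    (r.continuous.isClosedEmbedding r.injective).isEmbedding.secondCountableTopology
  obtain ⟨p, C₁, B, β₁, ℓ₁, hC₁, hℓ₁, hlaw⟩ := hRL
  obtain ⟨CA, hCA⟩ := exists_abs_plane_le r
  -- the nonnegative exponent `B⁺ = max B 0`
  set B' : ℝ := max B 0 with hB'
  have hB'0 : 0 ≤ B' := le_max_right _ _
  have hBB' : B ≤ B' := le_max_left _ _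
  refine ⟨2 * C₁ * ((2 + Real.exp B') * Real.exp B'), β₁, ℓ₁, hℓ₁, by positivity, ?_⟩
  intro β hβ L q x R hq hR hRa hRL hsep
  haveI := isProbabilityMeasure_wilsonMeasure (d := 4) (L := 2 * L + 1) r.ρ r.continuous β
  have hR0 : (0 : ℝ) < (R : ℝ) ^ 4 := by positivity
  -- a local bound for the two reference values
  set P₀ : ℝ := |p (q 0) β| + |p (q 1) β| with hP₀
  have hp : ∀ i : Fin 2, |p (q i) β| ≤ P₀ := by
    intro i
    fin_cases i
    · show |p (q 0) β| ≤ P₀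
      rw [hP₀]; linarith [abs_nonneg (p (q 1) β)]
    · show |p (q 1) β| ≤ P₀
      rw [hP₀]; linarith [abs_nonneg (p (q 0) β)]
  have hP₀0 : 0 ≤ P₀ := by rw [hP₀]; positivity
  -- the rescaled responses `Z_i` (rate of RM₁) and the influence functionals `Y_i = Z_i / 2`
  set Z : Fin 2 → LGConfig 4 G → ℝ := fun i η =>
    (R : ℝ) ^ 4 / C₁ * |kerE G r β (fun k => x i k - ((R : ℤ) + 1)) (2 * R + 3) η (plane G r (q i) (x i)) - p (q i) β|
    with hZ
  set Y : Fin 2 → LGConfig 4 G → ℝ := fun i η =>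
    (R : ℝ) ^ 4 / (2 * C₁) *
      |kerE G r β (fun k => x i k - ((R : ℤ) + 1)) (2 * R + 3) η (plane G r (q i) (x i)) - p (q i) β|
    with hY
  have hYZ : ∀ i η, Y i η = Z i η / 2 := fun i η => by
    simp only [hY, hZ]; ring
  have hZ0 : ∀ i η, 0 ≤ Z i η := fun i η => by simp only [hZ]; positivity
  have hY0 : ∀ i η, 0 ≤ Y i η := fun i η => by simp only [hY]; positivity
  have hZc : ∀ i, Continuous (Z i) := fun i =>
    ((continuous_kerE_plane r β _ _ (q i) (x i)).sub continuous_const).abs.const_mul _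
  have hYc : ∀ i, Continuous (Y i) := fun i =>
    ((continuous_kerE_plane r β _ _ (q i) (x i)).sub continuous_const).abs.const_mul _
  have hYm : ∀ i, Measurable (Y i) := fun i => (hYc i).measurable
  have hkerb : ∀ i η, |kerE G r β (fun k => x i k - ((R : ℤ) + 1)) (2 * R + 3) η (plane G r (q i) (x i)) -
      p (q i) β| ≤ CA + P₀ := fun i η =>
    (abs_sub _ _).trans (add_le_add (abs_kerE_plane_le r β _ _ (q i) (x i) hCA η) (hp i))
  have hYb : ∀ i η, Y i η ≤ (R : ℝ) ^ 4 / (2 * C₁) * (CA + P₀) := fun i η => by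
    simp only [hY]
    exact mul_le_mul_of_nonneg_left (hkerb i η) (by positivity)
  -- the singleton laws on the torus (RM₁ at the two cubes)
  have hZle : ∀ i : Fin 2, ∫ V, Real.exp (Z i (torusLift (2 * L + 1) V))
      ∂(wilsonMeasure (d := 4) (L := 2 * L + 1) r.ρ β) ≤ Real.exp B := fun i =>
    hlaw β hβ L (q i) (x i) R (hq i) hR hRa hRL
  have hZint : ∀ i : Fin 2, Integrable (fun V => Real.exp (Z i (torusLift (2 * L + 1) V)))
      (wilsonMeasure (d := 4) (L := 2 * L + 1) r.ρ β) := by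
    intro i
    have hc : Continuous fun V : GaugeConfig 4 (2 * L + 1) G => Real.exp (Z i (torusLift (2 * L + 1) V)) :=
      Real.continuous_exp.comp ((hZc i).comp (continuous_torusLift (2 * L + 1)))
    obtain ⟨C, hC⟩ := exists_bound_of_continuous hc
    exact integrable_of_bound hc.aestronglyMeasurable hC
  -- joint exponential moments of the half-rate influence over every `T ⊆ Fin 2`
  have hmom : ∀ T : Finset (Fin 2),
      ∫ V, Real.exp (∑ i ∈ T, Y i (torusLift (2 * L + 1) V)) ∂(wilsonMeasure (d := 4) (L := 2 * L + 1) r.ρ β) ≤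
        Real.exp (B' * T.card) := by
    intro T
    by_cases hT : T = ∅
    · subst hT
      simp
    · have hcard : (1 : ℝ) ≤ (T.card : ℝ) := by
        exact_mod_cast Finset.card_pos.2 (Finset.nonempty_iff_ne_empty.2 hT)
      have hpt : ∀ η : LGConfig 4 G,
          Real.exp (∑ i ∈ T, Y i η) ≤ (Real.exp (Z 0 η) + Real.exp (Z 1 η)) / 2 := by
        intro η
        have hsum : ∑ i ∈ T, Y i η ≤ ∑ i, Y i η :=
          Finset.sum_le_univ_sum_of_nonneg fun i => hY0 i η
        rw [Fin.sum_univ_two, hYZ 0 η, hYZ 1 η, ← add_div] at hsum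
        exact (Real.exp_le_exp.2 hsum).trans (exp_half_add_le _ _)
      have hc : Continuous fun V : GaugeConfig 4 (2 * L + 1) G =>
          Real.exp (∑ i ∈ T, Y i (torusLift (2 * L + 1) V)) :=
        Real.continuous_exp.comp (continuous_finsetSum T fun i _ => (hYc i).comp (continuous_torusLift (2 * L + 1)))
      obtain ⟨C, hC⟩ := exists_bound_of_continuous hc
      have hint : Integrable (fun V : GaugeConfig 4 (2 * L + 1) G =>
          Real.exp (∑ i ∈ T, Y i (torusLift (2 * L + 1) V))) (wilsonMeasure (d := 4) (L := 2 * L + 1) r.ρ β) :=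
        integrable_of_bound hc.aestronglyMeasurable hC
      calc ∫ V, Real.exp (∑ i ∈ T, Y i (torusLift (2 * L + 1) V)) ∂(wilsonMeasure (d := 4) (L := 2 * L + 1) r.ρ β)
          ≤ ∫ V, (Real.exp (Z 0 (torusLift (2 * L + 1) V)) + Real.exp (Z 1 (torusLift (2 * L + 1) V))) / 2
              ∂(wilsonMeasure (d := 4) (L := 2 * L + 1) r.ρ β) :=
            integral_mono hint (((hZint 0).add (hZint 1)).div_const 2) fun V => hpt _
        _ = ((∫ V, Real.exp (Z 0 (torusLift (2 * L + 1) V)) ∂(wilsonMeasure (d := 4) (L := 2 * L + 1) r.ρ β)) +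
              ∫ V, Real.exp (Z 1 (torusLift (2 * L + 1) V)) ∂(wilsonMeasure (d := 4) (L := 2 * L + 1) r.ρ β)) / 2 := by
            rw [integral_div, integral_add (hZint 0) (hZint 1)]
        _ ≤ (Real.exp B + Real.exp B) / 2 := by gcongr <;> exact hZle _
        _ = Real.exp B := by ring
        _ ≤ Real.exp (B' * T.card) := Real.exp_le_exp.2 (hBB'.trans (le_mul_of_one_le_right hB'0 hcard))
  -- the geometry of the two radius-`R+1` cubes (verbatim the data of `momentBounds6_of_temperedResponse`)
  have hmeas : ∀ i : Fin 2, Measurable (plane G r (q i) (x i)) := fun i =>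
    (continuous_plane r (q i) (x i)).measurable
  have hAc : ∀ i : Fin 2, Continuous fun U => plane G r (q i) (x i) U - p (q i) β := fun i =>
    (continuous_plane r (q i) (x i)).sub continuous_const
  have hAb : ∀ (i : Fin 2) (U : LGConfig 4 G), |plane G r (q i) (x i) U - p (q i) β| ≤ CA + P₀ :=
    fun i U => (abs_sub _ _).trans (add_le_add (hCA _ _ _) (hp i))
  have hAS : ∀ i : Fin 2, IsCylinder (fun U => plane G r (q i) (x i) U - p (q i) β)
      (cubeEdges (fun k => x i k - ((R : ℤ) + 1)) (2 * R + 3)) :=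
    fun i U V hUV => by simp only [isCylinder_plane_cube r hR (q i) (x i) hUV]
  have hinj : ∀ i : Fin 2, Set.InjOn (Torus.proj (2 * L + 1))
      (((cubeEdges (fun k => x i k - ((R : ℤ) + 1)) (2 * R + 3) ∪ cubeEdges (fun k => x i k - ((R : ℤ) + 1)) (2 * R + 3) ∪
          (plaquettesTouching (cubeEdges (fun k => x i k - ((R : ℤ) + 1)) (2 * R + 3))).biUnion plaquetteEdges).image
          Prod.fst : Set (Fin 4 → ℤ))) := fun i => injOn_torusProj_cube hRL (x i)
  have hfar : ∀ i j : Fin 2, i ≠ j → ∀ e ∈ cubeEdges (fun k => x j k - ((R : ℤ) + 1)) (2 * R + 3) ∪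
      (plaquettesTouching (cubeEdges (fun k => x j k - ((R : ℤ) + 1)) (2 * R + 3))).biUnion plaquetteEdges,
      ∀ e' ∈ cubeEdges (fun k => x i k - ((R : ℤ) + 1)) (2 * R + 3),
      torusEdge (2 * L + 1) e ≠ torusEdge (2 * L + 1) e' :=
    fun i j hij e he e' he' => torusEdge_ne_cube (hsep i j hij) he he'
  have hm : ∀ i : Fin 2, torusE G r β L (plane G r (q i) (x i)) - p (q i) β =
      ∫ W, (plane G r (q i) (x i) (torusLift (2 * L + 1) W) - p (q i) β)
        ∂(wilsonMeasure (d := 4) (L := 2 * L + 1) r.ρ β) := fun i =>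
    (integral_sub_const_of_abs_le (μ := wilsonMeasure (d := 4) (L := 2 * L + 1) r.ρ β)
      ((continuous_plane r (q i) (x i)).comp (continuous_torusLift (2 * L + 1))).measurable
      (fun W => hCA (q i) (x i) (torusLift (2 * L + 1) W)) (p (q i) β)).symm
  -- the tempered response law is an identity for the half-rate influence
  have hker : ∀ (i : Fin 2) (η : LGConfig 4 G),
      |(∫ U, (plane G r (q i) (x i) U - p (q i) β) ∂(ymSpecification r.ρ β
        (cubeEdges (fun k => x i k - ((R : ℤ) + 1)) (2 * R + 3)) η)) - 0| ≤
        2 * C₁ / (R : ℝ) ^ 4 * (1 + Y i η) := fun i η => by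
    haveI := isProbabilityMeasure_ymSpecification r.ρ r.continuous β
      (cubeEdges (fun k => x i k - ((R : ℤ) + 1)) (2 * R + 3)) η
    rw [sub_zero, integral_sub_const_of_abs_le (hmeas i) (fun U => hCA (q i) (x i) U) (p (q i) β)]
    have hid : 2 * C₁ / (R : ℝ) ^ 4 * (1 + Y i η) = 2 * C₁ / (R : ℝ) ^ 4 +
        |kerE G r β (fun k => x i k - ((R : ℤ) + 1)) (2 * R + 3) η (plane G r (q i) (x i)) - p (q i) β| := by
      simp only [hY]
      field_simp
    rw [hid]
    show |kerE G r β (fun k => x i k - ((R : ℤ) + 1)) (2 * R + 3) η (plane G r (q i) (x i)) - p (q i) β| ≤ _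
    linarith [div_nonneg (by positivity : (0 : ℝ) ≤ 2 * C₁) hR0.le]
  have key := abs_integral_prod_sub_mean_le_of_response (d := 4) r.ρ r.continuous β (L := 2 * L + 1) (n := 2)
      (fun i => cubeEdges (fun k => x i k - ((R : ℤ) + 1)) (2 * R + 3))
      (fun i => cubeEdges (fun k => x i k - ((R : ℤ) + 1)) (2 * R + 3))
      (fun i U => plane G r (q i) (x i) U - p (q i) β) hAc hAb hAS hinj hfar
      (fun i => torusE G r β L (plane G r (q i) (x i)) - p (q i) β) hm
      Y hYm hY0 (MY := (R : ℝ) ^ 4 / (2 * C₁) * (CA + P₀)) hYb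
      (p := 0) (ε := 2 * C₁ / (R : ℝ) ^ 4) (B := B') (by positivity) hker hmom
  simp only [sub_sub_sub_cancel_right] at key
  refine key.trans (le_of_eq ?_)
  congr 1
  field_simp

end Summit.QuantumFields.YangMills.Theorems.PairCollarOfResponse

end
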